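import Summits.CriticalPhenomena.PercolationContinuityZ3.Theorems.PercNearOneGluingNoHeavyLowerTailSunflowerBernsteinFamIn
import HarnessLib

/-!
# `NoHeavyLowerTail` (crux stmt-CriticalPhenomena-4575), abstract sunflower cubic: THE PENTAGON CORE `C₅` — COMPILED BERNSTEIN CERTIFICATES

Support file (seat `prim-ineq-prove-1` gen 38; `--supports stmt-CriticalPhenomena-4575`; `--computational`: `native_decide`
evaluations of the Boolean certificate `Bern.certifyA`, nothing else).  No `sorry`, no named facts.
Memo: run/shared/lean/prim/prim-ineq-prove-1/FINDING-BERNSTEIN-prove1-g38.md §1–§2.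

`C` indexes the four minimal transversals `{1,3}, {0,2,3}, {0,2,4}, {1,2,4}` of the path core
`P₅ = x₀x₁ ∨ x₁x₂ ∨ x₂x₃ ∨ x₃x₄`.  For every tuple of `k = 2, 3, 4` nonempty pairwise disjoint sub-families (by their codes
`u_i ⊆ Fin 4`) the safety polynomial `famIn(∅)^(k−1) − ∏ famIn(u_i)` (…SunflowerBernsteinFamIn) passes the scaled tensor-Bernstein
certificate (…SunflowerBernsteinPoly): `chk2`, `chk3`, `chk4`.  The assembly `Pentagon.safe_core : ∀ p, Safe p core` is in
…SunflowerBernsteinPentagon.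
-/

namespace Summit.CriticalPhenomena.PercolationContinuityZ3.Theorems.SunflowerPartition

namespace SafeCalc

namespace Pentagon

open Finset Bern

/-- The five minimal transversals (minimal vertex covers) of the pentagon core `C₅` (cycle `0 – 1 – 2 – 3 – 4 – 0`). [this work] -/
def C : Fin 5 → Finset (Fin 5) := ![{0, 1, 3}, {0, 2, 3}, {0, 2, 4}, {1, 2, 4}, {1, 3, 4}]

/-- The transversals are pairwise distinct. [this work] -/
theorem C_injective : Function.Injective C := by decide

/-- Certificates for two nonempty disjoint sub-families (codes sorted by minima). [this work] -/
theorem chk2 :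
    ∀ u0 : Finset (Fin 5), u0.Nonempty →
    ∀ u1 : Finset (Fin 5), u1.Nonempty → Disjoint u0 u1 → u0.min < u1.min →
    certifyA 5 2 (safetyArr C 1 ![u0, u1]) = true := by
  native_decide

set_option synthInstance.maxHeartbeats 400000 in
set_option synthInstance.maxSize 2048 in
/-- Certificates for five nonempty pairwise disjoint sub-families (codes sorted by minima). [this work] -/
theorem chk5 :
    ∀ u0 : Finset (Fin 5), u0.Nonempty →
    ∀ u1 : Finset (Fin 5), u1.Nonempty → Disjoint u0 u1 → u0.min < u1.min →
    ∀ u2 : Finset (Fin 5), u2.Nonempty → Disjoint u0 u2 → Disjoint u1 u2 → u1.min < u2.min →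
    ∀ u3 : Finset (Fin 5), u3.Nonempty → Disjoint u0 u3 → Disjoint u1 u3 → Disjoint u2 u3 → u2.min < u3.min →
    ∀ u4 : Finset (Fin 5), u4.Nonempty → Disjoint u0 u4 → Disjoint u1 u4 → Disjoint u2 u4 → Disjoint u3 u4 → u3.min < u4.min →
    certifyA 5 5 (safetyArr C 4 ![u0, u1, u2, u3, u4]) = true := by
  native_decide

end Pentagon

end SafeCalc

end Summit.CriticalPhenomena.PercolationContinuityZ3.Theorems.SunflowerPartition
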